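import Summits.BirchSwinnertonDyer.BirchSwinnertonDyer.Theorems.ManinLocalTwoThreeBracketSturmOneFiftyTwoB
import HarnessLib

/-!
# Level 152 = 2³·19 (C2 domain, `8 ∥ 152`; genus 17; TWO classes `152a`, `152b`) COMPLETE: `|c| = 1` — hence `2 ∤ c` — for EVERY lattice-optimal
# `X₀(152)`-datum of EVERY globally minimal elliptic curve over `ℚ`, UNCONDITIONALLY

Cell `bsd-f2-manin`, route `ManinLocalTwoThree`, crux C2 `ManinOddAtFour` (stmt-BirchSwinnertonDyer-22967: `2² ∣ 152`); prover seat p2 gen 31; `--supports`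
(helper).  ASSEMBLY: an g55's FACT-FREE two-row kernel pinning `PinningOneFiftyTwo.pinning` (rows `152a`: `d′ = 40`, `152b`: `d′ = 200`, on the
`24`-quotient `η`-basis of `M₂(Γ₀(152))`; landed by LEAD p1 g26) + this seat's DEEP tables (`…EtaTablesOneFiftyTwoDeep*`, depth `242 = μ₀ + 2`, STAGED
dense certificates with pentagonal Euler tables) + the two Bracket–Sturm certificates `…BracketSturmOneFiftyTwoA/B` (`152a1 = [0,1,0,−1,3]`,
`152b1 = [0,1,0,−8,−16]`; `(B, A)` by exact linear algebra, nullity `8`; one defect decide each; Sturm `240 < 242`): **`|c| = 1` and `2 ∤ c` on `X₀(152)`**.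
HONEST FRAMING: unconditional (standard axioms); ONE level of C2 — nothing here proves C2 for all `N`, Manin's conjecture or BSD; item 22967 stays OPEN.
[cite: Manin1972, Prop. 1.4] [cite: Sturm1987, Thm. 1] [cite: AgasheRibetStein2006, §§1–2] [cite: CremonaAlgorithms1997, §2.10, Table 1 (152a1, 152b1), Table 3 (N = 152)]
[cite: Koehler2011, §2.1]
-/

set_option autoImplicit false
-- lint-debt: the directory name repeats the summit name (sibling precedent `ManinLocalTwoThreeManinConstantEightyEight.lean`)
set_option linter.dupNamespace false

noncomputable section

open Complex
open UpperHalfPlane hiding I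
open scoped MatrixGroups ModularForm
open ModularForm CongruenceSubgroup PowerSeries
open Literature.NumberTheory.ModularForms
open Literature.NumberTheory.EllipticCurves Literature.NumberTheory.EllipticCurves.ModularForms

namespace Summit.BirchSwinnertonDyer.BirchSwinnertonDyer.Theorems.ManinLocalTwoThree.LevelOneFiftyTwo

open Summit.BirchSwinnertonDyer.BirchSwinnertonDyer.Theorems.ManinLocalTwoThree.BracketSturm Summit.BirchSwinnertonDyer.BirchSwinnertonDyer.Theorems.ManinLocalTwoThree.PinningKernel Summit.BirchSwinnertonDyer.BirchSwinnertonDyer.Theorems.ManinLocalTwoThree.PinningOneFiftyTwo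

/-- **`|c| = 1` FOR EVERY LATTICE-OPTIMAL `X₀(152)`-DATUM of every globally minimal elliptic curve over `ℚ`** — UNCONDITIONAL (both pinning rows).
[cite: Manin1972, Prop. 1.4] [cite: AgasheRibetStein2006, §§1–2] [cite: CremonaAlgorithms1997, Table 1 (152a1, 152b1)] -/
theorem abs_maninConstant_eq_one_oneFiftyTwo (W : WeierstrassCurve ℚ) [W.IsElliptic] [W.IsGloballyMinimal]
    (D : ModularParametrizationData W 152) (hopt : ∀ z ∈ D.L.lattice, ∃ w ∈ periodLattice D.f, z = D.c * w) :
    |D.maninConstant| = 1 := by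
  obtain ⟨C, hC, c, hc, -, hpin⟩ := pinning D
  rw [show goodCerts = [rowA, rowB] from rfl] at hc
  simp only [List.mem_cons, List.mem_nil_iff, or_false] at hc
  rcases hc with rfl | rfl
  · exact abs_maninConstant_eq_one_oneFiftyTwoA_of_row W D hopt C hC hpin
  · exact abs_maninConstant_eq_one_oneFiftyTwoB_of_row W D hopt C hC hpin

/-- **C2 `ManinOddAtFour` at `N = 152` (`2² ∣ 152`): `2 ∤ c(D)`** for every lattice-optimal `X₀(152)`-datum — UNCONDITIONAL. [cite: AgasheRibetStein2006, §§1–2] -/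
theorem not_two_dvd_maninConstant_oneFiftyTwo (W : WeierstrassCurve ℚ) [W.IsElliptic] [W.IsGloballyMinimal]
    (D : ModularParametrizationData W 152) (hopt : ∀ z ∈ D.L.lattice, ∃ w ∈ periodLattice D.f, z = D.c * w) :
    ¬ (2 : ℤ) ∣ D.maninConstant := by
  have h := abs_maninConstant_eq_one_oneFiftyTwo W D hopt
  intro h2
  have := Int.le_of_dvd (by rw [h]; norm_num) ((dvd_abs _ _).mpr h2)
  rw [h] at this
  norm_num at this

/-- **The C2 conclusion on the whole `X₀(152)`-domain**: `2² ∣ 152`, and `|c| = 1 ∧ 2 ∤ c` for every lattice-optimal `X₀(152)`-datum of every globally minimal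
elliptic curve over `ℚ` — UNCONDITIONAL; BSD and C2 for general `N` are NOT proved by this. [folklore] -/
theorem maninOddAtFour_oneFiftyTwo :
    2 ^ 2 ∣ 152 ∧ ∀ (W : WeierstrassCurve ℚ) [W.IsElliptic] [W.IsGloballyMinimal] (D : ModularParametrizationData W 152),
      (∀ z ∈ D.L.lattice, ∃ w ∈ periodLattice D.f, z = D.c * w) → |D.maninConstant| = 1 ∧ ¬ (2 : ℤ) ∣ D.maninConstant :=
  ⟨⟨38, by norm_num⟩, fun W _ _ D hopt ↦ ⟨abs_maninConstant_eq_one_oneFiftyTwo W D hopt, not_two_dvd_maninConstant_oneFiftyTwo W D hopt⟩⟩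

end Summit.BirchSwinnertonDyer.BirchSwinnertonDyer.Theorems.ManinLocalTwoThree.LevelOneFiftyTwo

end
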